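import Mathlib
import HarnessLib
import Summits.SmoothPoincare4.Statement
import Literature.Topology.FourManifolds.HomotopySpheres
import Literature.Topology.FourManifolds.Gluing
import Literature.Topology.FourManifolds.Handles
import Literature.Topology.FourManifolds.CerfGammaFourProofs
import Summits.SmoothPoincare4.SmoothPoincare4.Theses.RootDecompAE

/-!
# Line «mazur-seams» for the crux `RootDecompAE.SeifertTwistedDoublesStandard` (stmt-SmoothPoincare4-32000)

SKELETON (decomp-sp4 lens 2, gen 10; CRUX-PLAN shape (A); writer W1 form: hypothesis-free composition only): three registered stubs and the
kernel-checked composition `SeifertTwistedDoublesStandard_of : …RootDecompAE.SeifertTwistedDoublesStandard` (concludes the crux BY NAME, by cases,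
using `stub_mazurDouble` / `stub_mazurCorkSeams` / `stub_nonMazurSeifert` directly — the binder form
`MazurDoubleSphereFour → MazurCorkSeamsStandard → NonMazurSeifertTwistedDoublesStandard → STD` is the lens kernel's, MazurSeamDichotomy.lean).
Cut = structural dichotomy on the PAIR (piece C, seam ψ):
* `stub_mazurDouble`      — FLOOR, an IN-TREE THEOREM: verbatim the named fact `Literature.Topology.FourManifolds.Mazur1961_double_sphere_four`
  (MazurDouble.lean:46), proved in tree by `Literature.Topology.FourManifolds.Mazur1961_double_sphere_four_holds` (MazurDoubleHolds.lean:2570);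
  registered as a stub ONLY because the farm snapshot of 2026-08-30 has `MazurDouble(Holds)` unbuilt (`lean check` → remote:stale:unbuilt) —
  it closes by `exact Literature.Topology.FourManifolds.Mazur1961_double_sphere_four_holds` once that module is built (same body ⇒ defeq);
* `stub_mazurCorkSeams`   — LOAD-BEARING (species R): Mazur-type piece, non-extendable (loose-cork) seam, Seifert boundary ⟹ C ∪_ψ C ≅ S⁴ for X ≃ₕ S⁴;
* `stub_nonMazurSeifert`  — GENERIC stratum: non-Mazur-type contractible piece with aspherical-Seifert boundary ⟹ twisted doubles standard.
The Mazur-type + extendable-seam stratum is discharged INSIDE the composition (`mazurExtendableSeams_standard`, from `stub_mazurDouble` and the tree's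
`IsBoundaryGluing.isDouble_of_extends`).  Sorries: exactly 3, one per `stub_*`; nothing else.  Line card: `Lines/mazur-seams.md`.
-/

set_option linter.dupNamespace false

noncomputable section

open scoped Manifold ContDiff Topology
open Set Function Literature.Topology.FourManifolds

namespace Summit.SmoothPoincare4.SmoothPoincare4.Cruxes.SeifertTwistedDoublesStandard.MazurSeams

/-! ### Registered stubs -/

/-- FLOOR stub (in-tree theorem; closes by `exact Literature.Topology.FourManifolds.Mazur1961_double_sphere_four_holds` once the farm builds
`Literature.Topology.FourManifolds.MazurDoubleHolds`). -/
theorem stub_mazurDouble :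
  ∀ (W : Type) [TopologicalSpace W] [T2Space W] [SecondCountableTopology W]
    [ChartedSpace (EuclideanHalfSpace 4) W] [IsManifold (𝓡∂ 4) ∞ W] [CompactSpace W]
    [ContractibleSpace W],
    HasHandleDecomposition 3 W (fun k => if k ≤ 2 then 1 else 0) →
    ∀ (b : BoundaryData (𝓡∂ 4) W (𝓡 3))
      (P : Type) [TopologicalSpace P] [T2Space P] [SecondCountableTopology P]
      [ChartedSpace (EuclideanSpace ℝ (Fin 4)) P] [IsManifold (𝓡 4) ∞ P],
    IsDouble b (𝓡 4) P → Nonempty (P ≃ₘ⟮𝓡 4, 𝓡 4⟯ Metric.sphere (0 : EuclideanSpace ℝ (Fin 5)) 1) := by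
  sorry

/-- LOAD-BEARING stub (species R; rows and instruments in `Lines/mazur-seams.md`). -/
theorem stub_mazurCorkSeams :
  ∀ (C : Type) [TopologicalSpace C] [T2Space C] [SecondCountableTopology C] [ChartedSpace (EuclideanHalfSpace 4) C]
    [IsManifold (𝓡∂ 4) ∞ C] [CompactSpace C] [ContractibleSpace C] (bC : BoundaryData (𝓡∂ 4) C (𝓡 3))
    (ψ : bC.carrier ≃ₘ⟮𝓡 3, 𝓡 3⟯ bC.carrier),
    HasHandleDecomposition 3 C (fun k => if k ≤ 2 then 1 else 0) →
    (∃ (y : bC.carrier) (g : FundamentalGroup bC.carrier y), ¬ IsOfFinOrder g ∧ (Subgroup.zpowers g).Normal) →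
    (¬ ∃ Φ : C ≃ₘ⟮𝓡∂ 4, 𝓡∂ 4⟯ C, ∀ z, Φ (bC.incl z) = bC.incl (ψ z)) →
    ∀ (X : Type) [TopologicalSpace X] [T2Space X] [SecondCountableTopology X] [ChartedSpace (EuclideanSpace ℝ (Fin 4)) X]
    [IsManifold (𝓡 4) ∞ X], ContinuousMap.HomotopyEquiv X (Metric.sphere (0 : EuclideanSpace ℝ (Fin 5)) 1) →
      IsBoundaryGluing bC bC ψ (𝓡 4) X → Nonempty (X ≃ₘ⟮𝓡 4, 𝓡 4⟯ (Metric.sphere (0 : EuclideanSpace ℝ (Fin 5)) 1)) := by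
  sorry

/-- GENERIC stub (no known row; test T-SFS-NONMAZUR in `Lines/mazur-seams.md`). -/
theorem stub_nonMazurSeifert :
  ∀ (C : Type) [TopologicalSpace C] [T2Space C] [SecondCountableTopology C] [ChartedSpace (EuclideanHalfSpace 4) C]
    [IsManifold (𝓡∂ 4) ∞ C] [CompactSpace C] [ContractibleSpace C] (bC : BoundaryData (𝓡∂ 4) C (𝓡 3))
    (ψ : bC.carrier ≃ₘ⟮𝓡 3, 𝓡 3⟯ bC.carrier),
    ¬ HasHandleDecomposition 3 C (fun k => if k ≤ 2 then 1 else 0) →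
    (∃ (y : bC.carrier) (g : FundamentalGroup bC.carrier y), ¬ IsOfFinOrder g ∧ (Subgroup.zpowers g).Normal) →
    ∀ (X : Type) [TopologicalSpace X] [T2Space X] [SecondCountableTopology X] [ChartedSpace (EuclideanSpace ℝ (Fin 4)) X]
    [IsManifold (𝓡 4) ∞ X], ContinuousMap.HomotopyEquiv X (Metric.sphere (0 : EuclideanSpace ℝ (Fin 5)) 1) →
      IsBoundaryGluing bC bC ψ (𝓡 4) X → Nonempty (X ≃ₘ⟮𝓡 4, 𝓡 4⟯ (Metric.sphere (0 : EuclideanSpace ℝ (Fin 5)) 1)) := by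
  sorry

/-! ### Kernel-checked composition -/

section Seam

variable {C : Type} [TopologicalSpace C] [ChartedSpace (EuclideanHalfSpace 4) C] [IsManifold (𝓡∂ 4) ∞ C]
  {bC : BoundaryData (𝓡∂ 4) C (𝓡 3)} {ψ : bC.carrier ≃ₘ⟮𝓡 3, 𝓡 3⟯ bC.carrier}
  {X : Type} [TopologicalSpace X] [ChartedSpace (EuclideanSpace ℝ (Fin 4)) X]

/-- A seam that is the boundary restriction of a self-diffeomorphism of the piece gives the untwisted double
(tree `IsBoundaryGluing.isDouble_of_extends` applied to `Φ⁻¹`). -/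
theorem isDouble_of_seam_extends (h : IsBoundaryGluing bC bC ψ (𝓡 4) X) (Φ : C ≃ₘ⟮𝓡∂ 4, 𝓡∂ 4⟯ C)
    (hΦ : ∀ z, Φ (bC.incl z) = bC.incl (ψ z)) : IsDouble bC (𝓡 4) X := by
  refine IsBoundaryGluing.isDouble_of_extends (φ := ψ.toEquiv) h Φ.symm fun z => ?_
  have h1 : Φ (bC.incl (ψ.symm z)) = bC.incl z := by
    rw [hΦ, Diffeomorph.apply_symm_apply]
  change Φ.symm (bC.incl z) = bC.incl (ψ.symm z)
  rw [← h1, Diffeomorph.symm_apply_apply]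

end Seam

/-- **COMPOSITION (concludes the crux BY NAME, hypothesis-free; writer W1 form after the #31190 bounce: no binder-form theorem in the file)**:
by cases on «C Mazur-type» and «ψ extends over C», using the three registered stubs directly; statements INLINED over tree/Mathlib declarations only (no local defs). -/
theorem SeifertTwistedDoublesStandard_of :
    Summit.SmoothPoincare4.SmoothPoincare4.Theses.RootDecompAE.SeifertTwistedDoublesStandard := by
  intro C _ _ _ _ _ _ _ bC ψ hS X _ _ _ _ _ e hglue
  by_cases hM : HasHandleDecomposition 3 C (fun k => if k ≤ 2 then 1 else 0)
  · by_cases hE : ∃ Φ : C ≃ₘ⟮𝓡∂ 4, 𝓡∂ 4⟯ C, ∀ z, Φ (bC.incl z) = bC.incl (ψ z)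
    · -- Mazur-type piece with EXTENDABLE seam: the untwisted double, discharged by the floor stub (tree theorem) — no sorry of its own
      obtain ⟨Φ, hΦ⟩ := hE
      exact stub_mazurDouble C hM bC X (isDouble_of_seam_extends hglue Φ hΦ)
    · exact stub_mazurCorkSeams C bC ψ hM hS hE X e hglue
  · exact stub_nonMazurSeifert C bC ψ hM hS X e hglue

end Summit.SmoothPoincare4.SmoothPoincare4.Cruxes.SeifertTwistedDoublesStandard.MazurSeams

end
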